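import Mathlib
import Summits.Ventures.HodgeRepro.Tier4.Line1.ArchMatrixCoeff

/-!
# Tier4/Line1/HeckeDoubleCoset — the characteristic functions of the double cosets `K g₀ K` of a compact open `K` are
left-`K`-invariant test functions, so the whole spherical Hecke algebra of level `K` (times matrix coefficients) has
finite-rank left-`K`-type

Blind re-derivation cell `pub-hodge-repro`, Tier 4 (README §9–§10), seat t4-L1-p2 (gen 4), LINE L1.  Target tree path
`lean/Summits/Ventures/HodgeRepro/Tier4/Line1/HeckeDoubleCoset.lean`.  Imports this seat's `ArchMatrixCoeff` (and through
it `LeftTypeOfMatrixCoeff`: `HasFiniteRankLeftType`, `coeffFn`, `hasFiniteRankLeftType_coeffFn`, `.finset_sum`,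
`.const_mul`) — generic over a Hausdorff topological group `G`; 0 print.

WHAT THIS IS.  `ArchMatrixCoeff.isTest_indicator_of_compactOpen` gives the level function `1_K`.  The Hecke operators
of level `K` are the characteristic functions `1_{K g₀ K}` of the double cosets and their finite linear combinations:

* `doubleCoset K g₀ := (K : Set G) * {g₀} * K`; for a compact open `K` it is compact (`IsCompact.mul`), open
  (`IsOpen.mul_left`), hence clopen in the Hausdorff `G`, so `1_{K g₀ K}` is a test function
  (`isTest_indicator_doubleCoset`) and left-`K`-invariant (`indicator_doubleCoset_left_invariant`: `k · (K g₀ K) = K g₀ K`);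
* `hasFiniteRankLeftType_doubleCoset_coeff` — `1_{K g₀ K} · (A ·) i j` has finite-rank left-`K`-type for every
  matrix-valued homomorphism `A` with continuous entries;
* `hasFiniteRankLeftType_heckeSum` — every finite linear combination `∑ₗ cₗ · 1_{K gₗ K} · (A ·) iₗ jₗ` (an element of the
  spherical Hecke algebra of level `K` tensored with the matrix coefficients of `A`) has finite-rank left-`K`-type, so
  `Setting.exists_finset_specBlock_support_of_hasFiniteRankLeftType` applies: (S1b) holds for every test pair whose
  first member is such a Hecke element (`exists_finset_specBlock_support_of_heckeSum`).

On L1's instance `K = finLevel pl N` is compact open on a totally definite plane (`TotallyDefiniteCompact`,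
`CMPlaneTotallyDefinite`), so these are the genuine level-`N` Hecke operators with archimedean type `std`.

JUNK TESTS.  `g₀ = 1`: `K · 1 · K = K`, the level function itself.  `K = ⊤` on a non-compact `G`: not compact — the
hypotheses exclude it.  The empty sum: the zero function, rank `0`.

NOT claimed: the dictionary `tf` (which Hecke element is which translate), (S1a), (S3′), `P_T4`.  Nothing here says
anything about the status of the Hodge conjecture for CM abelian varieties, which is NOT proved (HC_CM is NOT proved by
anyone in this repository).
-/

set_option autoImplicit false

noncomputable section

namespace Summit.Ventures.HodgeRepro.Tier4.Line1

open MeasureTheory Topology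
open scoped Pointwise

section DoubleCoset

variable {G : Type} [Group G] [TopologicalSpace G] [IsTopologicalGroup G]

/-- **the double coset `K g₀ K`** of a subgroup `K`, as a set. -/
def doubleCoset (K : Subgroup G) (g₀ : G) : Set G := (K : Set G) * {g₀} * (K : Set G)

/-- the double coset of a compact subgroup is compact. -/
theorem isCompact_doubleCoset (K : Subgroup G) (hc : IsCompact (K : Set G)) (g₀ : G) :
    IsCompact (doubleCoset K g₀) :=
  (hc.mul isCompact_singleton).mul hc

/-- the double coset of an open subgroup is open. -/
theorem isOpen_doubleCoset (K : Subgroup G) (ho : IsOpen (K : Set G)) (g₀ : G) : IsOpen (doubleCoset K g₀) :=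
  ho.mul_left

omit [TopologicalSpace G] [IsTopologicalGroup G] in
/-- the double coset is left-`K`-invariant: `k ∈ K`, `g ∈ K g₀ K` gives `k * g ∈ K g₀ K`, and conversely. -/
theorem mul_mem_doubleCoset_iff (K : Subgroup G) (g₀ : G) {x : G} (hx : x ∈ K) (g : G) :
    x * g ∈ doubleCoset K g₀ ↔ g ∈ doubleCoset K g₀ := by
  constructor
  · rintro ⟨y, ⟨a, ha, b, hb, rfl⟩, c, hc, hyc⟩
    change a * b * c = x * g at hyc
    refine ⟨x⁻¹ * a * b, ⟨x⁻¹ * a, K.mul_mem (K.inv_mem hx) ha, b, hb, rfl⟩, c, hc, ?_⟩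
    show x⁻¹ * a * b * c = g
    calc x⁻¹ * a * b * c = x⁻¹ * (a * b * c) := by simp only [mul_assoc]
      _ = x⁻¹ * (x * g) := by rw [hyc]
      _ = g := inv_mul_cancel_left x g
  · rintro ⟨y, ⟨a, ha, b, hb, rfl⟩, c, hc, rfl⟩
    refine ⟨x * a * b, ⟨x * a, K.mul_mem hx ha, b, hb, rfl⟩, c, hc, ?_⟩
    show x * a * b * c = x * (a * b * c)
    simp only [mul_assoc]

omit [TopologicalSpace G] [IsTopologicalGroup G] in
/-- the characteristic function of the double coset is left-`K`-invariant. -/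
theorem indicator_doubleCoset_left_invariant (K : Subgroup G) (g₀ : G) :
    ∀ x ∈ K, ∀ g, Set.indicator (doubleCoset K g₀) (fun _ => (1 : ℂ)) (x * g) =
      Set.indicator (doubleCoset K g₀) (fun _ => (1 : ℂ)) g := by
  intro x hx g
  by_cases hg : g ∈ doubleCoset K g₀
  · rw [Set.indicator_of_mem ((mul_mem_doubleCoset_iff K g₀ hx g).2 hg), Set.indicator_of_mem hg]
  · rw [Set.indicator_of_notMem (fun h => hg ((mul_mem_doubleCoset_iff K g₀ hx g).1 h)), Set.indicator_of_notMem hg]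

/-- **the characteristic function of a double coset of a compact open subgroup is a test function** (`G` Hausdorff:
the compact double coset is closed, so clopen). -/
theorem isTest_indicator_doubleCoset [T2Space G] (K : Subgroup G) (hc : IsCompact (K : Set G))
    (ho : IsOpen (K : Set G)) (g₀ : G) :
    RTF.IsTest (Set.indicator (doubleCoset K g₀) fun _ => (1 : ℂ)) := by
  have hcpt := isCompact_doubleCoset K hc g₀
  have hcl : IsClosed (doubleCoset K g₀) := hcpt.isClosed
  refine ⟨?_, ?_⟩
  · refine continuous_const.indicator fun a ha => ?_
    rw [IsClopen.frontier_eq ⟨hcl, isOpen_doubleCoset K ho g₀⟩] at ha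
    exact (Set.notMem_empty a ha).elim
  · exact HasCompactSupport.intro' hcpt hcl fun x hx => Set.indicator_of_notMem hx _

/-- **a Hecke operator of level `K` times a matrix coefficient has finite-rank left-`K`-type**. -/
theorem hasFiniteRankLeftType_doubleCoset_coeff [T2Space G] (K : Subgroup G) (hc : IsCompact (K : Set G))
    (ho : IsOpen (K : Set G)) (g₀ : G) {d : ℕ} (A : G →* Matrix (Fin d) (Fin d) ℂ) (i j : Fin d)
    (hA : ∀ l j, Continuous fun g => A g l j) :
    RTF.HasFiniteRankLeftType K (RTF.coeffFn A i j (Set.indicator (doubleCoset K g₀) fun _ => (1 : ℂ))) :=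
  RTF.hasFiniteRankLeftType_coeffFn K A i j _ (isTest_indicator_doubleCoset K hc ho g₀)
    (indicator_doubleCoset_left_invariant K g₀) hA

/-- **a Hecke element of level `K`**: a finite linear combination of double-coset characteristic functions times
matrix coefficients, `∑ₗ cₗ · 1_{K gₗ K} · (A ·) (iₗ) (jₗ)`. -/
def heckeSum (K : Subgroup G) {d : ℕ} (A : G →* Matrix (Fin d) (Fin d) ℂ) {ι : Type} (F : Finset ι) (c : ι → ℂ)
    (g₀ : ι → G) (i j : ι → Fin d) : G → ℂ :=
  fun g => ∑ l ∈ F, c l * RTF.coeffFn A (i l) (j l) (Set.indicator (doubleCoset K (g₀ l)) fun _ => (1 : ℂ)) g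

/-- **every Hecke element of level `K` has finite-rank left-`K`-type** (`K` compact open, `G` Hausdorff). -/
theorem hasFiniteRankLeftType_heckeSum [T2Space G] (K : Subgroup G) (hc : IsCompact (K : Set G))
    (ho : IsOpen (K : Set G)) {d : ℕ} (A : G →* Matrix (Fin d) (Fin d) ℂ) (hA : ∀ l j, Continuous fun g => A g l j)
    {ι : Type} (F : Finset ι) (c : ι → ℂ) (g₀ : ι → G) (i j : ι → Fin d) :
    RTF.HasFiniteRankLeftType K (heckeSum K A F c g₀ i j) :=
  RTF.HasFiniteRankLeftType.finset_sum F _ fun l _ =>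
    (hasFiniteRankLeftType_doubleCoset_coeff K hc ho (g₀ l) A (i l) (j l) hA).const_mul (c l)

/-- a Hecke element is a test function (a finite sum of scalar multiples of test functions). -/
theorem isTest_heckeSum [T2Space G] (K : Subgroup G) (hc : IsCompact (K : Set G)) (ho : IsOpen (K : Set G))
    {d : ℕ} (A : G →* Matrix (Fin d) (Fin d) ℂ) (hA : ∀ l j, Continuous fun g => A g l j) {ι : Type} (F : Finset ι)
    (c : ι → ℂ) (g₀ : ι → G) (i j : ι → Fin d) : RTF.IsTest (heckeSum K A F c g₀ i j) := by
  have hl : ∀ l, RTF.IsTest fun g =>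
      c l * RTF.coeffFn A (i l) (j l) (Set.indicator (doubleCoset K (g₀ l)) fun _ => (1 : ℂ)) g := fun l => by
    have ht := RTF.isTest_coeffFn A (i l) (j l) _ (isTest_indicator_doubleCoset K hc ho (g₀ l)) (hA _ _)
    exact ⟨continuous_const.mul ht.cont, ht.compact.mul_left⟩
  refine ⟨continuous_finsetSum F fun l _ => (hl l).cont, ?_⟩
  have heq : heckeSum K A F c g₀ i j = ∑ l ∈ F, (fun g =>
      c l * RTF.coeffFn A (i l) (j l) (Set.indicator (doubleCoset K (g₀ l)) fun _ => (1 : ℂ)) g) := by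
    funext g
    simp only [heckeSum, Finset.sum_apply]
  rw [heq]
  exact HasCompactSupport.finset_sum fun l _ => (hl l).compact

end DoubleCoset

namespace RTF.Setting

variable {G : Type} [Group G] [TopologicalSpace G] [IsTopologicalGroup G] [MeasurableSpace G] [BorelSpace G]
  (S : Setting G) (χ : S.T → ℂ) (χ' : S.T' → ℂ) (φ : ℕ → G → ℂ) (n : ℕ → ℕ) (f₂ : G → ℂ)

/-- **(S1b) FOR THE SPHERICAL HECKE ALGEBRA OF A COMPACT OPEN LEVEL** (the theorem of record of this file): for a
compact open `K` of a Hausdorff `G`, a matrix-valued homomorphism `A` with continuous entries and ANY Hecke element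
`∑ₗ cₗ · 1_{K gₗ K} · (A ·) (iₗ) (jₗ)`, the test pair `(heckeSum, f₂)` has a finite spectrum. -/
theorem exists_finset_specBlock_support_of_heckeSum [Countable S.Gk] [T2Space G] (K : Subgroup G)
    (hc : IsCompact (K : Set G)) (ho : IsOpen (K : Set G)) {τ : ℕ → Set (G → ℂ)} (hB : S.IsAdaptedONB τ φ n)
    {d : ℕ} (A : G →* Matrix (Fin d) (Fin d) ℂ) (hA : ∀ l j, Continuous fun g => A g l j) {ι : Type} (F : Finset ι)
    (c : ι → ℂ) (g₀ : ι → G) (i j : ι → Fin d) :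
    ∃ s : Finset ℕ, ∀ m ∉ s, specBlock S χ χ' φ n (heckeSum K A F c g₀ i j) f₂ m = 0 :=
  S.exists_finset_specBlock_support_of_hasFiniteRankLeftType χ χ' φ n (heckeSum K A F c g₀ i j) f₂ K ho hB
    (isTest_heckeSum K hc ho A hA F c g₀ i j) (hasFiniteRankLeftType_heckeSum K hc ho A hA F c g₀ i j)

end RTF.Setting



end Summit.Ventures.HodgeRepro.Tier4.Line1

end
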